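import Summits.QuantumFields.YangMills.Theorems.FluctuationComparisonRegPrIntLS2BetaPeanoSmooth
import HarnessLib

/-!
# S2β · POS∘ — THE TAYLOR HALF (T2e): THE MATRIX FIELD OF THE CHARTED CONFIGURATION IS `C^∞` ALONG THE TRANSVERSAL — the `coeField` edition of ✓(C2) `…S2BetaPeanoSmooth`

Cell `ym3-torus` (YM ladder rung R3 = continuum `SU(2)` Yang–Mills on the three-torus at fixed lattice data — a RUNG: NOT d = 4, NOT infinite volume,
NOT a mass gap, NOT Clay).  Width seat `ym3-torus-px21` (gen 18); (T)-chain of px8 g18's pen «Taylor half» (✓(T1) p793318, ✓(T2a) p793856, (T2b)∕(T2c)∕(T2d)).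
Crux `stmt-QuantumFields-20520` (`…Theses.UnitScaleTilt.FluctuationComparisonRegPrIntL`), LINE g18-1 S2β; `--kind proof --supports stmt-QuantumFields-20520 --as helper`, count-neutral,
DEFINITION-FREE (0 `def`, 0 `instance`, 0 `notation`, 0 `sorry`, default heartbeats).

WHY.  (T2b)∕(T2c) display the row `hΦs : ContDiffAt ℝ 2 (fun y => coeField (Φ (σ y))) 0` (resp. `hΦd : DifferentiableAt …`) for the re-solved transversal of a fibred chart — the
dictionary row `D (Φ (σ y)) ≤ C‖y‖²` ((T2a) §3) and the `C²` input of (T1) both read the MATRIX FIELD, not only the action.  w5-20520 g14's ✓`…S2BetaPeanoSmooth.contDiffAt_wilsonAction4_windowChart`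
proves `C^m` of the ACTION `y ↦ A (c.Φ (V, σ y))` from the window-chart clauses of ✓`exists_laplaceRows` by ✓(C2-c) `contDiffAt_wilsonAction4_resolve` — which is itself
✓`contDiffAt_coeField_resolve` composed with the ambient action.  THIS FILE stops one step earlier: under the SAME clause list, the matrix field `y ↦ ↑(c.Φ (V, σ y))` is `C^m` at `0`.
Proof = the ✓PeanoSmooth proof verbatim ((C2-a) ✓`contDiffAt_pivotRead`, (C2-b) ✓`isInvertible_fderiv_chainRead` ∕ `chainRead_contDiffAt_surjective` through ✓`pivotRead_base_eq_chainMap`,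
✓`isInvertible_inr_of_blocks`) ending in ✓`contDiffAt_coeField_resolve`.

* ★★★ `contDiffAt_coeField_windowChart` — clauses ⊢ `ContDiffAt ℝ m (fun y => coeField (c.Φ (V, σ y))) 0`; ★★★ `contDiffAt_coeField_windowChart_of_histGood` — the loop-history guard from
  `U₀ ∈ histGood` + the regime inequalities (✓`loopHist_le_of_mem_histGood`); `differentiableAt_coeField_windowChart_of_histGood` ((T2b)'s `hΦd`).

HONEST: assembly; proves no stub; HESS∘, ISOL∘(δ), TUBE-REG∘, GAP♯∘, EXW∘, LAPLACE, S2β, crux 20520 NOT proved; `YM3TorusSU2` NOT proved; rung R3 = SU(2) YM₃ on T³ — NOT d = 4, NOT infinite volume,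
NOT a mass gap, NOT Clay; the Yang–Mills mass gap is NOT proved.  Sorry-free, axioms standard.

References: [Balaban1987RG1] CMP 109 (1987) (0.4) p.253, p.267 (after (2.10)); [Balaban1985Variational] CMP 102 (1985) Thm 1 (8)–(10) p.279; [Balaban1985UV3] CMP 102 (1985) (7) p.257;
[Dieudonne1960] Ch. X §2 (10.2.1)–(10.2.3).
-/

set_option autoImplicit false

noncomputable section

open scoped Matrix.Norms.L2Operator Topology ContDiff
open Filter Set Function
open Literature.MathematicalPhysics.QuantumFieldTheory.Balaban1983to89
open Literature.MathematicalPhysics.QuantumFieldTheory.Balaban1983to89.HaarExponentialChart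
open Literature.MathematicalPhysics.QuantumFieldTheory.Balaban1983to89.HaarExponentialChart.IsChartRep
open Literature.MathematicalPhysics.QuantumFieldTheory.Balaban1983to89.BlockAveraging (Small Idx avgFun loopHol blockAvg blockAvg_avg)
open Literature.MathematicalPhysics.QuantumFieldTheory.Balaban1983to89.ExpMeanLog (expMeanLogSU deltaSU deltaSU_pos)
open Literature.MathematicalPhysics.QuantumFieldTheory.Balaban1983to89.Node00
open Literature.MathematicalPhysics.QuantumFieldTheory.Balaban1983to89.T3ContinuumYM3Torus
open Literature.MathematicalPhysics.QuantumFieldTheory.Balaban1983to89.T3UnitLawDensityEML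
open Literature.MathematicalPhysics.QuantumFieldTheory.Balaban1983to89.T3UnitScaleTilt
open Literature.MathematicalPhysics.QuantumFieldTheory.Balaban1983to89.T3TiltDescent
open Summit.QuantumFields.YangMills.Theorems.FluctuationComparisonRegPrIntLWregGlue
open Summit.QuantumFields.YangMills.Theorems.FluctuationComparisonRegPrIntLWregChain (iterCentralBond iterCentralBond_injective chainMap)
open Summit.QuantumFields.YangMills.Theorems.FluctuationComparisonRegPrIntLS2BetaPivotReadSmooth
open Summit.QuantumFields.YangMills.Theorems.FluctuationComparisonRegPrIntLS2BetaPivotResolveSmooth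
open Summit.QuantumFields.YangMills.Theorems.FluctuationComparisonRegPrIntLS2BetaChainDerivative
open Summit.QuantumFields.YangMills.Theorems.FluctuationComparisonRegPrIntLS2BetaPeanoSmooth

namespace Summit.QuantumFields.YangMills.Theorems.FluctuationComparisonRegPrIntLS2BetaCoeFieldSmoothWindowChart

variable (F : T3Family) {J K : ℕ} (hJK : J ≤ K)
variable {dV : ℕ}

/-- ★★★ **(C2′) THE MATRIX FIELD OF THE CHARTED CONFIGURATION IS `C^m` ALONG THE TRANSVERSAL.**  Same data and clauses as ✓`contDiffAt_wilsonAction4_windowChart` (window chart `c`, corner `V`,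
base point `U₀`, clauses `hdesc hoff hΦc hlive hself hnhds hU₀V`, loop-history guard `hhist`, tube rows `hσc hσ0 hσs`); conclusion `ContDiffAt ℝ m (fun y => coeField (c.Φ (V, σ y))) 0` —
(T2b)'s `hΦd` ∕ (T2c)'s `hΦs` for `Φ := c.Φ (V, ·)`. [cite: Balaban1985Variational, Thm 1 (8)-(10) p.279] [cite: Balaban1987RG1, p.267 (after (2.10))] [cite: Dieudonne1960, Ch. X §2 (10.2.1)–(10.2.3)] -/
theorem contDiffAt_coeField_windowChart (hk : K - J ≤ (F.P K).m + (F.P K).K) {α : ℝ} (hα24 : α ≤ 1 / 24) (hαδ : α < deltaSU (Fin 2))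
    (hαL : 157 * α < ((((F.P K).L : ℕ) : ℝ) ^ ((F.P K).d - 1))⁻¹)
    {Sf : Set (GaugeField (F.P K) 0 (Matrix.specialUnitaryGroup (Fin 2) ℂ))} {O : Set (GaugeField (F.P J) 0 (Matrix.specialUnitaryGroup (Fin 2) ℂ))}
    (c : WindowChart F hJK Sf O) (V : GaugeField (F.P J) 0 (Matrix.specialUnitaryGroup (Fin 2) ℂ)) (U₀ : GaugeField (F.P K) 0 (Matrix.specialUnitaryGroup (Fin 2) ℂ))
    (hdesc : ∀ z, c.jac (V, z) ≠ 0 → descendTo F ℰp J K hJK (c.Φ (V, z)) = V)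
    (hoff : ∀ z, c.jac (V, z) ≠ 0 → ∀ b, (∀ c', iterCentralBond (K - J) c' ≠ b) → c.Φ (V, z) b = z b)
    (hΦc : ContinuousOn (fun z => c.Φ (V, z)) {z | c.jac (V, z) ≠ 0})
    (hlive : c.jac (V, U₀) ≠ 0) (hself : c.Φ (V, U₀) = U₀) (hnhds : {z | c.jac (V, z) ≠ 0} ∈ 𝓝 U₀)
    (hU₀V : descendTo F ℰp J K hJK U₀ = V)
    (hhist : ∀ k, k < K - J → ∀ (c' : PBond (F.P K) (k + 1)) (i : Idx (F.P K)),
      dist1 (loopHol (Averaging.iter (fun j => blockAvg (P := F.P K) (j := j) (expMeanLogSU (n := Fin 2))) k U₀) c' i) ≤ α)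
    (σ : EuclideanSpace ℝ (Fin dV) → GaugeField (F.P K) 0 (Matrix.specialUnitaryGroup (Fin 2) ℂ)) (hσc : Continuous σ) (hσ0 : σ 0 = U₀)
    (hσs : ContDiff ℝ ⊤ (fun y : EuclideanSpace ℝ (Fin dV) => fun b : PBond (F.P K) 0 =>
      ((σ y b : Matrix.specialUnitaryGroup (Fin 2) ℂ) : Matrix (Fin 2) (Fin 2) ℂ)))
    (m : WithTop ℕ∞) :
    ContDiffAt ℝ m (fun y => coeField (c.Φ (V, σ y))) 0 := by
  have hU₀ : SmallBelow (fun j => blockAvg (P := F.P K) (j := j) (expMeanLogSU (n := Fin 2))) (K - J) U₀ := smallBelow_of_loopHist_le hαδ hhist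
  have hσs' : ContDiffAt ℝ ⊤ (fun y => coeField (σ y)) 0 := hσs.contDiffAt
  -- (C2-b): the pivot-derivative of the read along `σ` is invertible, block by block
  have hR := contDiffAt_pivotRead (n := K - J) U₀ hU₀ σ hσc hσ0 hσs'
  have hinv := isInvertible_inr_of_blocks (hR.differentiableAt (by simp))
    (φ := fun c' X => (isChartRep_specialUnitaryGroup (n := Fin 2)).logChart
      (chainMap (expMeanLogSU (n := Fin 2)) (K - J) U₀ c' ((isChartRep_specialUnitaryGroup (n := Fin 2)).expChart X * U₀ (iterCentralBond (K - J) c')) *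
        (Averaging.iter (fun j => blockAvg (P := F.P K) (j := j) (expMeanLogSU (n := Fin 2))) (K - J) U₀ c')⁻¹))
    (fun X c' => by
      show (isChartRep_specialUnitaryGroup (n := Fin 2)).logChart
        (Averaging.iter (fun j => blockAvg (P := F.P K) (j := j) (expMeanLogSU (n := Fin 2))) (K - J)
            (extend (iterCentralBond (K - J)) (fun c'' => (isChartRep_specialUnitaryGroup (n := Fin 2)).expChart (X c'') * U₀ (iterCentralBond (K - J) c'')) (σ 0)) c' *
          (Averaging.iter (fun j => blockAvg (P := F.P K) (j := j) (expMeanLogSU (n := Fin 2))) (K - J) U₀ c')⁻¹) = _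
      rw [hσ0]
      exact pivotRead_base_eq_chainMap hk U₀ X c')
    (fun c' => ((chainRead_contDiffAt_surjective (P := F.P K) (N := 2) hα24 hαδ hαL hk U₀ c' hhist).2.1.differentiableAt (by simp)))
    (fun c' => isInvertible_fderiv_chainRead (P := F.P K) (N := 2) hα24 hαδ hαL hk U₀ c' hhist)
  -- (C2-c), matrix-field edition, with the chart clauses
  refine (contDiffAt_coeField_resolve (n := K - J) U₀ hU₀ σ hσc hσ0 hσs' (fun z => c.Φ (V, z)) {z | c.jac (V, z) ≠ 0}
    (fun z hz b hb => hoff z hz b hb) (fun z hz => ?_) (hΦc.continuousWithinAt hlive) hself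
    (hσc.continuousAt.preimage_mem_nhds (by rw [hσ0]; exact hnhds)) hinv).of_le le_top
  exact iter_eq_of_descendTo_eq F hJK ((hdesc z hz).trans hU₀V.symm)

/-- ★★★ **(C2′) AT A POINT OF THE UV-SMALL-HISTORY EVENT**: as `contDiffAt_coeField_windowChart`, with the loop-history guard DERIVED from `U₀ ∈ histGood F 𝓔 θ K J` and the regime inequalities
(`0 ≤ θ(i)`, `((d+2)L)²∕4 · θ(i) ≤ α`; ✓`loopHist_le_of_mem_histGood`). [cite: Balaban1985UV3, (7) p.257] [cite: Balaban1985Variational, Thm 1 (8)-(10) p.279] [cite: Dieudonne1960, Ch. X §2 (10.2.1)] -/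
theorem contDiffAt_coeField_windowChart_of_histGood (hk : K - J ≤ (F.P K).m + (F.P K).K) {α : ℝ} (hα24 : α ≤ 1 / 24) (hαδ : α < deltaSU (Fin 2))
    (hαL : 157 * α < ((((F.P K).L : ℕ) : ℝ) ^ ((F.P K).d - 1))⁻¹) {θ : ℕ → ℝ} (hθ0 : ∀ i, 0 ≤ θ i)
    (hθα : ∀ i, ((((F.P K).d + 2) * (F.P K).L : ℕ) : ℝ) ^ 2 / 4 * θ i ≤ α)
    {Sf : Set (GaugeField (F.P K) 0 (Matrix.specialUnitaryGroup (Fin 2) ℂ))} {O : Set (GaugeField (F.P J) 0 (Matrix.specialUnitaryGroup (Fin 2) ℂ))}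
    (c : WindowChart F hJK Sf O) (V : GaugeField (F.P J) 0 (Matrix.specialUnitaryGroup (Fin 2) ℂ)) (U₀ : GaugeField (F.P K) 0 (Matrix.specialUnitaryGroup (Fin 2) ℂ))
    (hdesc : ∀ z, c.jac (V, z) ≠ 0 → descendTo F ℰp J K hJK (c.Φ (V, z)) = V)
    (hoff : ∀ z, c.jac (V, z) ≠ 0 → ∀ b, (∀ c', iterCentralBond (K - J) c' ≠ b) → c.Φ (V, z) b = z b)
    (hΦc : ContinuousOn (fun z => c.Φ (V, z)) {z | c.jac (V, z) ≠ 0})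
    (hlive : c.jac (V, U₀) ≠ 0) (hself : c.Φ (V, U₀) = U₀) (hnhds : {z | c.jac (V, z) ≠ 0} ∈ 𝓝 U₀)
    (hU₀V : descendTo F ℰp J K hJK U₀ = V) (hU₀h : U₀ ∈ histGood F ℰp θ K J)
    (σ : EuclideanSpace ℝ (Fin dV) → GaugeField (F.P K) 0 (Matrix.specialUnitaryGroup (Fin 2) ℂ)) (hσc : Continuous σ) (hσ0 : σ 0 = U₀)
    (hσs : ContDiff ℝ ⊤ (fun y : EuclideanSpace ℝ (Fin dV) => fun b : PBond (F.P K) 0 =>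
      ((σ y b : Matrix.specialUnitaryGroup (Fin 2) ℂ) : Matrix (Fin 2) (Fin 2) ℂ)))
    (m : WithTop ℕ∞) :
    ContDiffAt ℝ m (fun y => coeField (c.Φ (V, σ y))) 0 :=
  contDiffAt_coeField_windowChart F hJK hk hα24 hαδ hαL c V U₀ hdesc hoff hΦc hlive hself hnhds hU₀V
    (loopHist_le_of_mem_histGood F hθ0 hθα hU₀h) σ hσc hσ0 hσs m

/-- (T2b)'s `hΦd` for the chart of record: the matrix field of `y ↦ c.Φ (V, σ y)` is differentiable at `0`. [cite: Balaban1985Variational, Thm 1 (8)-(10) p.279] -/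
theorem differentiableAt_coeField_windowChart_of_histGood (hk : K - J ≤ (F.P K).m + (F.P K).K) {α : ℝ} (hα24 : α ≤ 1 / 24) (hαδ : α < deltaSU (Fin 2))
    (hαL : 157 * α < ((((F.P K).L : ℕ) : ℝ) ^ ((F.P K).d - 1))⁻¹) {θ : ℕ → ℝ} (hθ0 : ∀ i, 0 ≤ θ i)
    (hθα : ∀ i, ((((F.P K).d + 2) * (F.P K).L : ℕ) : ℝ) ^ 2 / 4 * θ i ≤ α)
    {Sf : Set (GaugeField (F.P K) 0 (Matrix.specialUnitaryGroup (Fin 2) ℂ))} {O : Set (GaugeField (F.P J) 0 (Matrix.specialUnitaryGroup (Fin 2) ℂ))}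
    (c : WindowChart F hJK Sf O) (V : GaugeField (F.P J) 0 (Matrix.specialUnitaryGroup (Fin 2) ℂ)) (U₀ : GaugeField (F.P K) 0 (Matrix.specialUnitaryGroup (Fin 2) ℂ))
    (hdesc : ∀ z, c.jac (V, z) ≠ 0 → descendTo F ℰp J K hJK (c.Φ (V, z)) = V)
    (hoff : ∀ z, c.jac (V, z) ≠ 0 → ∀ b, (∀ c', iterCentralBond (K - J) c' ≠ b) → c.Φ (V, z) b = z b)
    (hΦc : ContinuousOn (fun z => c.Φ (V, z)) {z | c.jac (V, z) ≠ 0})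
    (hlive : c.jac (V, U₀) ≠ 0) (hself : c.Φ (V, U₀) = U₀) (hnhds : {z | c.jac (V, z) ≠ 0} ∈ 𝓝 U₀)
    (hU₀V : descendTo F ℰp J K hJK U₀ = V) (hU₀h : U₀ ∈ histGood F ℰp θ K J)
    (σ : EuclideanSpace ℝ (Fin dV) → GaugeField (F.P K) 0 (Matrix.specialUnitaryGroup (Fin 2) ℂ)) (hσc : Continuous σ) (hσ0 : σ 0 = U₀)
    (hσs : ContDiff ℝ ⊤ (fun y : EuclideanSpace ℝ (Fin dV) => fun b : PBond (F.P K) 0 =>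
      ((σ y b : Matrix.specialUnitaryGroup (Fin 2) ℂ) : Matrix (Fin 2) (Fin 2) ℂ))) :
    DifferentiableAt ℝ (fun y => coeField (c.Φ (V, σ y))) 0 :=
  (contDiffAt_coeField_windowChart_of_histGood F hJK hk hα24 hαδ hαL hθ0 hθα c V U₀ hdesc hoff hΦc hlive hself hnhds hU₀V hU₀h σ hσc hσ0 hσs 1).differentiableAt
    (by simp)

end Summit.QuantumFields.YangMills.Theorems.FluctuationComparisonRegPrIntLS2BetaCoeFieldSmoothWindowChart

end
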